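import Summits.BirchSwinnertonDyer.Rank1Residual.X2.GreenbergVatsalTateKummer
import Summits.BirchSwinnertonDyer.Rank1Residual.X2.GreenbergVatsalTateKummerTwoDivisible
import HarnessLib

/-!
# Greenberg LNM 1716 Prop. 2.4 «holds when `E` has multiplicative reduction» over the CYCLOTOMIC
# tower, EVERY `p` (the prime `2` included) — the named fact
# `Greenberg1999.imKummer_ge_strictCondition_multiplicative_cyclotomic` IS A THEOREM (`…_holds`)

HONEST FRAMING (cell `pub/bsd-cited`, ARM P of the BSD rank-`≤ 1` literature-to-partition
programme; seat `bsd-cited-r09`, base-role literature-prover work): nothing here proves BSD or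
moves a class label; this file turns ONE named PRINT fact of the tree into a kernel theorem
(D-0026: debt `−1`, no new fact, no `def`). The fact is the `p = 2`-admitting companion of
`Greenberg1999.imKummer_ge_strictCondition_multiplicative` (discharged for odd `p` in the sibling
`GreenbergVatsalTateKummer`), consumed (as the binder `hF2`, at universe `0`) by the
`ByReductionTypeAtTwoMultTransport*` kernel transports of the multiplicative-at-`2` classes.

THE PRINTED PROOF, FOLLOWED (Greenberg, LNM 1716, §2, proof of Prop. 2.4, pp. 74–75, and the
multiplicative remark p. 76). `K = (F_∞)_η`, `G = G_K = (ker κ)_v`, `C = C_v = ι⁻¹Ψ(μ)` the Tate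
line. Print: "`G_K` has `p`-cohomological dimension `1`. Hence `H¹(K, C_v)` must be divisible" —
done in cochain form in the sibling `GreenbergVatsalTateKummerTwoDivisible`
(`exists_cocycle_eq_two_nsmul_add_of_isCyclotomic`: every continuous `C`-valued cocycle `g` on
`G` is `2d + ∂c₀`). This REPLACES the pointwise halving of the odd-`p` proof (the only place where
`p ≠ 2` was used there); the remaining steps are the odd sibling's, BY NAME (§3
`strictKer_le_localKerOver_tate_of_twoDivisible`, any `H`, any `p`): on `G₁ = G ∩ Stab(√γ)` the
parametrisation is equivariant and continuous Hilbert 90 writes `ι∘d = ∂P₂`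
(`GreenbergVatsalTateKummerLocal.exists_point_of_values_in_roots`); across the quadratic character
`2(ι∘d − ∂P₂) = ∂R` (`…exists_two_nsmul_eq_of_vanishing_on_stabilizer`); hence
`ι∘f = ∂(R + 2P₂ + ιc₀ + ιm₀)` on `G` — the Kummer condition. §4 assembles the discharge at
universe `0` (the universe of the tree's `cd ≤ 1` theorem; every consumer binds `.{0}`).

## References
* R. Greenberg, *Iwasawa theory for elliptic curves*, LNM 1716 (1999), §2 Prop. 2.4 (pp. 74–75)
  and pp. 75–76; §4 Lemma 4.5. [GreenbergLNM1716]
* J.-P. Serre, *Cohomologie galoisienne*, II §3.3 Prop. 9; *Local Fields* X §1 Prop. 2.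
  [SerreGaloisCohomology1997] [SerreLocalFields1979]
* J. H. Silverman, *Advanced Topics in the Arithmetic of Elliptic Curves*, V.3.1, V.5.2–5.4.
  [SilvermanATAEC1994]
-/

noncomputable section

open scoped Classical

universe u

namespace Summit.BirchSwinnertonDyer.Rank1Residual.X2.GreenbergVatsalTateKummerCyclotomic

open NumberField IsDedekindDomain Field Literature.NumberTheory.GaloisRepresentations
  Literature.NumberTheory.EllipticCurves Literature.NumberTheory.EllipticCurves.GreenbergSelmer
  IsDedekindDomain.HeightOneSpectrum
  Summit.BirchSwinnertonDyer.Rank1Residual.X2.GreenbergVatsalTateKummerLocal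
  Summit.BirchSwinnertonDyer.Rank1Residual.X2.GreenbergVatsalTateKummerTwoDivisible

/-! ## §3. `Im(λ_K) ⊆ Im(κ_K)` for the Tate datum whenever `H¹(G, C)` is `2`-divisible (any `p`) -/

section Main

variable {F : Type u} [Field F] [NumberField F] (W : WeierstrassCurve F) (p : ℕ)
  {v : HeightOneSpectrum (𝓞 F)}
  (Ψ : Additive (AlgebraicClosure (v.adicCompletion F))ˣ →+ localPoints W (v.adicCompletion F))
  (t : AlgebraicClosure (v.adicCompletion F)) {q : v.adicCompletion F}
  (hq0 : q ≠ 0) (hq1 : Valued.v q < 1)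
  (hker : ∀ u : (AlgebraicClosure (v.adicCompletion F))ˣ, Ψ (Additive.ofMul u) = 0 →
    ∃ a : ℤ, (u : AlgebraicClosure (v.adicCompletion F)) =
      algebraMap (v.adicCompletion F) (AlgebraicClosure (v.adicCompletion F)) q ^ a)
  (hΨσ : ∀ (σ : absoluteGaloisGroup (v.adicCompletion F))
      (u : (AlgebraicClosure (v.adicCompletion F))ˣ),
    σ • Ψ (Additive.ofMul u) =
      (if Field.absoluteGaloisGroup.toAlgEquiv (v.adicCompletion F) σ t = t then (1 : ℤ)
        else -1) •
      Ψ (Additive.ofMul (Units.map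
        (Field.absoluteGaloisGroup.toAlgEquiv (v.adicCompletion F) σ :
          AlgebraicClosure (v.adicCompletion F) →* AlgebraicClosure (v.adicCompletion F)) u)))
  (N : LocalDatum F (W.geomPrimaryTorsion p) v)
  (hN : ∀ m : W.geomPrimaryTorsion p, m ∈ N.plus ↔
    ∃ ζ : (AlgebraicClosure (v.adicCompletion F))ˣ, IsOfFinOrder ζ ∧
      Ψ (Additive.ofMul ζ) = pointsMap W (v.adicCompletion F) (m : W.geomPoints))
  (H : Subgroup (absoluteGaloisGroup F))

include hq0 hq1 hker hΨσ hN in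
/-- **`Im(λ_K) ⊆ Im(κ_K)` for the Tate datum, ANY prime `p`, ANY `H ≤ Γ_F`, granted the
`2`-divisibility of `H¹(G_K, C)` in cochain form** (`h2div`: every continuous `C`-valued cocycle of
`G = H_{K_v}` is `2d + ∂c₀`). This is the sibling's `strictKer_le_localKerOver_tate` with its only
use of `p ≠ 2` — the pointwise halving of the `C`-valued cocycle `g₁ = f − ∂m₀` — replaced by
`h2div`; the rest is the printed Tate-parametrisation argument verbatim: on `G₁ = G ∩ Stab(t)` the
parametrisation is equivariant and continuous Hilbert 90 gives `ι∘d = ∂P₂`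
(`exists_point_of_values_in_roots`), `2(ι∘d − ∂P₂) = ∂R` across the quadratic character
(`exists_two_nsmul_eq_of_vanishing_on_stabilizer`), so `ι∘f = ∂(R + 2P₂ + ιc₀ + ιm₀)` on `G`.
[cite: GreenbergLNM1716, §2 pp. 74–76] [cite: SerreLocalFields1979, Ch. X §1 Prop. 2] -/
theorem strictKer_le_localKerOver_tate_of_twoDivisible
    (hts : ∀ σ : absoluteGaloisGroup (v.adicCompletion F), σ • t = t ∨ σ • t = -t)
    (h2div : ∀ g : localSubgroup H (v.adicCompletion F) → W.geomPrimaryTorsion p,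
      (∀ τ, g τ ∈ N.plus) → Continuous g →
      (∀ τ₁ τ₂, g (τ₁ * τ₂) = g τ₁ + resGal (K := F) (v.adicCompletion F)
        (τ₁ : absoluteGaloisGroup (v.adicCompletion F)) • g τ₂) →
      ∃ (d : localSubgroup H (v.adicCompletion F) → W.geomPrimaryTorsion p)
        (c₀ : W.geomPrimaryTorsion p),
        (∀ τ, d τ ∈ N.plus) ∧ c₀ ∈ N.plus ∧ Continuous d ∧
        (∀ τ₁ τ₂, d (τ₁ * τ₂) = d τ₁ + resGal (K := F) (v.adicCompletion F)
          (τ₁ : absoluteGaloisGroup (v.adicCompletion F)) • d τ₂) ∧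
        ∀ τ, g τ = 2 • d τ + (resGal (K := F) (v.adicCompletion F)
          (τ : absoluteGaloisGroup (v.adicCompletion F)) • c₀ - c₀)) :
    N.strictKer H ≤ W.localKerOver p H (v.adicCompletion F) := by
  intro c hc
  obtain ⟨f, rfl⟩ := oneCocycleClass_surjective (discreteTopRep H (W.geomPrimaryTorsion p)) c
  -- the strict condition on cocycles
  rw [LocalDatum.mem_strictKer_iff, LocalDatum.strictMap, resH1Hom_oneCocycleClass,
    oneCocycleClass_eq_zero_iff] at hc
  obtain ⟨b, hb⟩ := hc
  obtain ⟨m₀, hm₀⟩ := N.grMk_surjective b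
  have hstrict : ∀ x : decompIn H v,
      N.grMk (f.1 (decompInToH H v x)) = x • N.grMk m₀ - N.grMk m₀ := by
    intro x
    have h := hb x
    rw [contOneCocycles.pullback_apply] at h
    rw [hm₀]
    exact h
  -- notation: the local group `G`, its image in `H ⊓ D_v`
  set G := localSubgroup H (v.adicCompletion F) with hG
  have hxmem : ∀ τ : G, (⟨resGal (K := F) (v.adicCompletion F) τ, ⟨τ, rfl⟩⟩ : decomp (K := F) v) ∈
      decompIn H v := fun τ ↦
    (mem_decompIn_iff H v _).2 ((mem_localSubgroup_iff H (v.adicCompletion F) τ).1 τ.2)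
  set xd : G → decompIn H v := fun τ ↦ ⟨⟨resGal (K := F) (v.adicCompletion F) τ, ⟨τ, rfl⟩⟩, hxmem τ⟩
    with hxd
  have hxd_res : ∀ τ : G, decompInToH H v (xd τ) = resGalSubgroup H (v.adicCompletion F) τ :=
    fun τ ↦ Subtype.ext rfl
  -- (1) `g₁ = f − ∂m₀` has values in `C` on `G`, is a continuous cocycle
  set g₁ : G → W.geomPrimaryTorsion p := fun τ ↦
    f.1 (resGalSubgroup H (v.adicCompletion F) τ) -
      (resGal (K := F) (v.adicCompletion F) τ • m₀ - m₀) with hg₁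
  have hg₁C : ∀ τ : G, g₁ τ ∈ N.plus := by
    intro τ
    rw [← LocalDatum.ker_grMk, AddMonoidHom.mem_ker, hg₁]
    simp only [map_sub]
    rw [← hxd_res, hstrict (xd τ), Subgroup.smul_def, LocalDatum.smul_grMk]
    exact sub_self _
  have hg₁coc : ∀ τ₁ τ₂ : G, g₁ (τ₁ * τ₂) =
      g₁ τ₁ + resGal (K := F) (v.adicCompletion F) τ₁ • g₁ τ₂ := by
    intro τ₁ τ₂
    simp only [hg₁]
    rw [map_mul, f.2, Subgroup.coe_mul, map_mul, mul_smul]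
    change f.1 _ +
      (resGalSubgroup H (v.adicCompletion F) τ₁ : absoluteGaloisGroup F) • f.1 _ - _ = _
    rw [resGalSubgroup_apply_coe, smul_sub, smul_sub]
    abel
  have hg₁cont : Continuous g₁ := by
    simp only [hg₁]
    refine Continuous.sub ?_ (Continuous.sub ?_ continuous_const)
    · exact f.1.continuous.comp (resGalSubgroup H (v.adicCompletion F)).continuous_toFun
    · exact (W.continuous_smul_geomPrimaryTorsion p m₀).comp
        ((resGal (K := F) (v.adicCompletion F)).continuous_toFun.comp continuous_subtype_val)
  -- `H¹(G, C)` is `2`-divisible: `g₁ = 2 d + ∂c₀`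
  obtain ⟨d, c₀, hdC, hc₀C, hdcont, hdcoc, hd2⟩ := h2div g₁ hg₁C hg₁cont hg₁coc
  -- (2) on `G₁ = G ∩ Stab(t)`: continuous Hilbert 90
  set G₁ := G ⊓ MulAction.stabilizer (absoluteGaloisGroup (v.adicCompletion F)) t with hG₁
  have hG₁le : G₁ ≤ G := inf_le_left
  set d₁ : G₁ → W.geomPrimaryTorsion p := fun τ ↦ d (Subgroup.inclusion hG₁le τ) with hd₁
  have hΨG : ∀ τ : G₁, ∀ u : (AlgebraicClosure (v.adicCompletion F))ˣ,
      (τ : absoluteGaloisGroup (v.adicCompletion F)) • Ψ (Additive.ofMul u) =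
        Ψ (Additive.ofMul (Units.map
          (Field.absoluteGaloisGroup.toAlgEquiv (v.adicCompletion F) τ :
            AlgebraicClosure (v.adicCompletion F) →* AlgebraicClosure (v.adicCompletion F))
              u)) := by
    intro τ u
    have hτt : Field.absoluteGaloisGroup.toAlgEquiv (v.adicCompletion F) τ t = t := by
      rw [← Field.absoluteGaloisGroup.smul_def]
      exact MulAction.mem_stabilizer_iff.1 (Subgroup.mem_inf.1 τ.2).2
    rw [hΨσ, if_pos hτt, one_zsmul]
  have hd₁coc : ∀ τ₁ τ₂ : G₁, d₁ (τ₁ * τ₂) =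
      d₁ τ₁ + resGal (K := F) (v.adicCompletion F) (τ₁ : absoluteGaloisGroup (v.adicCompletion F)) •
        d₁ τ₂ := fun τ₁ τ₂ ↦
    hdcoc (Subgroup.inclusion hG₁le τ₁) (Subgroup.inclusion hG₁le τ₂)
  have hopen : IsOpen {τ : G₁ | d₁ τ = 0} := by
    have hset : {τ : G₁ | d₁ τ = 0} = (fun τ : G₁ ↦ d (Subgroup.inclusion hG₁le τ)) ⁻¹' {0} := by
      ext τ
      simp only [Set.mem_setOf_eq, Set.mem_preimage, Set.mem_singleton_iff, hd₁]
    rw [hset]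
    exact (isOpen_discrete _).preimage (hdcont.comp (continuous_inclusion hG₁le))
  have hC₁ : ∀ τ : G₁, ∃ ζ : (AlgebraicClosure (v.adicCompletion F))ˣ, IsOfFinOrder ζ ∧
      Ψ (Additive.ofMul ζ) = pointsMap W (v.adicCompletion F) (d₁ τ : W.geomPoints) :=
    fun τ ↦ (hN _).1 (hdC _)
  obtain ⟨P₂, hP₂⟩ := exists_point_of_values_in_roots W p Ψ hker hq0 hq1 G₁ hΨG d₁ hd₁coc hopen hC₁
  -- (3) the index-2 step for `e = ι∘d − ∂P₂` on `G`
  set e : G → localPoints W (v.adicCompletion F) := fun τ ↦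
    pointsMap W (v.adicCompletion F) (d τ : W.geomPoints) -
      ((τ : absoluteGaloisGroup (v.adicCompletion F)) • P₂ - P₂) with hedef
  have hecoc : ∀ τ₁ τ₂ : G, e (τ₁ * τ₂) =
      e τ₁ + (τ₁ : absoluteGaloisGroup (v.adicCompletion F)) • e τ₂ := by
    intro τ₁ τ₂
    simp only [hedef]
    rw [hdcoc, AddSubgroup.coe_add, map_add, primaryComponent.coe_smul, pointsMap_smul,
      Subgroup.coe_mul, mul_smul, smul_sub, smul_sub]
    abel
  have he1 : ∀ τ : G, (τ : absoluteGaloisGroup (v.adicCompletion F)) • t = t → e τ = 0 := by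
    intro τ hτ
    have hτ₁ : (τ : absoluteGaloisGroup (v.adicCompletion F)) ∈ G₁ :=
      Subgroup.mem_inf.2 ⟨τ.2, MulAction.mem_stabilizer_iff.2 hτ⟩
    have h := hP₂ ⟨τ, hτ₁⟩
    simp only [hd₁] at h
    have e1 : Subgroup.inclusion hG₁le ⟨(τ : absoluteGaloisGroup (v.adicCompletion F)), hτ₁⟩ = τ :=
      Subtype.ext rfl
    rw [e1] at h
    simp only [hedef]
    rw [h, sub_self]
  obtain ⟨R, hR⟩ := exists_two_nsmul_eq_of_vanishing_on_stabilizer (F := F) G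
    (fun τ ↦ hts τ) e hecoc he1
  -- (4) assemble the Kummer point `Q = R + 2 P₂ + ι c₀ + ι m₀`
  rw [GreenbergVatsalSelmerLink.oneCocycleClass_mem_localKerOver_iff]
  refine ⟨R + 2 • P₂ + pointsMap W (v.adicCompletion F) (c₀ : W.geomPoints) +
    pointsMap W (v.adicCompletion F) (m₀ : W.geomPoints), fun τ ↦ ?_⟩
  have hf : f.1 (resGalSubgroup H (v.adicCompletion F) τ) =
      2 • d τ + (resGal (K := F) (v.adicCompletion F) τ • c₀ - c₀) +
        (resGal (K := F) (v.adicCompletion F) τ • m₀ - m₀) := by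
    rw [← hd2]; simp only [hg₁]; abel
  have h2d : 2 • pointsMap W (v.adicCompletion F) (d τ : W.geomPoints) =
      2 • e τ + 2 • ((τ : absoluteGaloisGroup (v.adicCompletion F)) • P₂ - P₂) := by
    simp only [hedef]; rw [← smul_add, sub_add_cancel]
  rw [hf, AddSubgroup.coe_add, map_add, AddSubgroup.coe_add, map_add, AddSubmonoidClass.coe_nsmul,
    map_nsmul, h2d, hR, AddSubgroupClass.coe_sub, map_sub, AddSubgroupClass.coe_sub, map_sub,
    primaryComponent.coe_smul, pointsMap_smul, primaryComponent.coe_smul, pointsMap_smul]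
  simp only [smul_add, smul_sub, two_nsmul]
  abel

end Main

/-! ## §4. The discharge -/

/-- **The named fact `Greenberg1999.imKummer_ge_strictCondition_multiplicative_cyclotomic` IS A
THEOREM** (Greenberg, LNM 1716, Prop. 2.4 «holds when `E` has multiplicative reduction», pp. 74–76,
for `K = (F_∞)_η` the completion of the CYCLOTOMIC `ℤ_p`-extension, EVERY prime `p` — the prime
`2` included; the inclusion `Im(λ_K) ⊆ Im(κ_K)` for the Tate datum `C_v = ι⁻¹Ψ(μ)`), at universe `0`
(the universe of the tree's `cd_p((ker κ)_v) ≤ 1` theorem; every consumer binds `.{0}`). Proof =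
the printed one: `cd_p(G_K) ≤ 1 ⟹ H¹(K, C_v)` `2`-divisible (sibling
`GreenbergVatsalTateKummerTwoDivisible`) feeds the Tate-parametrisation / continuous-Hilbert-90
argument of p. 76 (§3). The multiplicative-reduction hypothesis and the surjectivity of `Ψ` are not
used beyond the shape of the Tate data (as in the odd-`p` sibling).
Consumers (`ByReductionTypeAtTwoMultTransport*`, binder `hF2`) may feed this theorem; the debt for
the fact is discharged (D-0026). [cite: GreenbergLNM1716, Prop. 2.4 (pp. 74–75) and §2 pp. 75–76]
[cite: SerreGaloisCohomology1997, II §3.3 Prop. 9] [cite: SerreLocalFields1979, Ch. X §1 Prop. 2] -/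
theorem imKummer_ge_strictCondition_multiplicative_cyclotomic_holds :
    Greenberg1999.imKummer_ge_strictCondition_multiplicative_cyclotomic.{0} := by
  intro F _ _ W _ p _ κ hκ v _hpv _hv q t Ψ hq0 hq1 ht _hsurj hker hΨσ N hN
  exact strictKer_le_localKerOver_tate_of_twoDivisible W p Ψ t hq0 hq1 (fun u h ↦ (hker u).1 h)
    hΨσ N hN κ.kerSubgroup (GreenbergVatsalTateKummer.smul_sqrt_eq_or W t ht)
    (exists_cocycle_eq_two_nsmul_add_of_isCyclotomic W p κ N hκ
      (exists_mem_plus_two_nsmul_eq W p Ψ N hN))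

end Summit.BirchSwinnertonDyer.Rank1Residual.X2.GreenbergVatsalTateKummerCyclotomic

end
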